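import Literature.AlgebraicGeometry.ComplexMultiplication.AndreProductFormGalois
import Literature.AlgebraicGeometry.ComplexMultiplication.CMTypeConjugateIsogeny
import Literature.AlgebraicGeometry.ComplexMultiplication.QuarticCMTypePairDichotomy
import Literature.AlgebraicGeometry.ComplexMultiplication.AbelianVarietyDomination
import Literature.AlgebraicGeometry.Pohlmann1968.CMTypeRankLowerBoundsNumberField
import Literature.FieldTheory.AlgClosed.AutFixedSubfield
import Literature.NumberTheory.ComplexMultiplication.CMFieldConjSquareQuadraticSubfields
import HarnessLib

/-!
# Quartic CM fields: the four embeddings `{a, ā, b, b̄}`, `Aut(K) = {1, c}` for a non-Galois quartic CM field, the dihedral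
# reflection and the `4`-cycle in the image of `Aut(ℂ)`, primitivity of every CM type of a non-Galois quartic CM field,
# and "complex conjugation on `Hom(K, ℂ)` is a square in `Aut(ℂ)`" (with Galois bookkeeping for cyclic sextic CM fields)

Galois-theoretic bookkeeping for Shimura's §8.4 Example (2) used throughout the low-dimension files: (Part 1) for a Galois
CM field complex conjugation is induced by `conjGal` under every embedding, has order `2`, and a Galois sextic CM field has
cyclic group generated by `σ` with `σ³ = ρ`; (Part 2) for `K/ℚ` Galois every embedding is a twist `a ∘ w`;
(Part 3) a non-cyclic group of order `4` has exponent `2`, so a biquadratic type `{a, a∘h}` is never separated from its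
partner; (Part 4) `Hom(K, ℂ) = {a, ā, b, b̄}` for a quartic CM field, `Aut(K) = {1, c}` when `K/ℚ` is not Galois, the
DIHEDRAL REFLECTION `τ ∘ a = a`, `τ ∘ b = b̄` exists for `b` not a twist of `a`, hence every CM type of a non-Galois quartic
CM field is PRIMITIVE (Kubota's criterion; its abelian surfaces are simple); (Part 5) a `4`-cycle `a ↦ b ↦ ā ↦ b̄` in the
image of `Aut(ℂ)`, so complex conjugation on `Hom(K, ℂ)` is a SQUARE `τ ∘ τ` for a non-Galois quartic CM field, and the
action of `Aut(ℂ)` on the two embeddings of an imaginary quadratic field (trivial or conjugation; squares act trivially).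

* Part 1 — from `CorCM/CyclicSexticCMTypes` (4/30 declarations; namespace
  `Literature.AlgebraicGeometry.ComplexMultiplication.CyclicSextic`): CM types of a Galois SEXTIC CM field, I: cyclic
  Galois group, coordinates on the embeddings, indicator calculus. Declarations: `conjugate_eq_comp_conjGal`,
  `orderOf_conjGal`, `card_gal_eq_six`, `exists_generator`.
* Part 2 — from `CorCM/QuarticCMTypeSlice` (4/18 declarations; namespace
  `Literature.AlgebraicGeometry.ComplexMultiplication.Domination.AVDominatedBy`): The QUARTIC slice of `HC_CM`,
  unconditionally: CM inside a quartic CM field without imaginary quadratic subfield. Declarations: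
  `comp_algEquiv_injective`, `exists_eq_comp_algEquiv`, `comp_algEquiv_comp`, `smul_comp_algEquiv`.
* Part 3 — from `CorCM/QuarticCMTypeSliceBiquadratic` (3/10 declarations; namespace
  `Literature.AlgebraicGeometry.ComplexMultiplication.QuarticCM`): The QUARTIC slice of `HC_CM`, IV: biquadratic
  fields — the slice for EVERY quartic CM field, no hypothesis. Declarations: `mul_self_eq_one_of_not_isCyclic`,
  `comp_mem_iff_of_pair`, `forall_smul_mem_iff_of_mul_self_eq_one`.
* Part 4 — from `CorCM/QuarticCMTypeReflection` (14/16 declarations; namespace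
  `Literature.AlgebraicGeometry.ComplexMultiplication.QuarticCM`): CM types of a QUARTIC CM field, I: the four
  embeddings, `Aut(K)`, the dihedral reflection, primitivity. Declarations: `card_ringHom_eq_four`, `conjugate_ne`,
  `smul_conjugate`, `univ_eq_four`, `eq_or_eq_or_eq_or_eq`, `sum_eq_add_four`, `exists_mem_mem_ne`,
  `card_algEquiv_le_four`, `algEquiv_eq_one_or_eq_conjGal_of_not_isGalois`,
  `exists_algEquiv_comp_eq_of_forall_mem_range`, `exists_ringAut_smul_eq_self_smul_eq_conjugate`,
  `exists_ringAut_smul_eq_self_smul_eq_conjugate_of_not_isGalois`, `isPrimitive_of_reflection`,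
  `isPrimitive_of_not_isGalois`.
* Part 5 — from `CorCM/QuarticCMConjugationSquare` (7/12 declarations; namespace
  `Literature.AlgebraicGeometry.ComplexMultiplication.QuarticCM`): CM types of a QUARTIC CM field, IV: for `K/ℚ` not
  Galois, complex conjugation on `Hom(K, ℂ)` is the SQUARE of an. Declarations: `exists_ne_ne_conjugate`,
  `exists_ringAut_smul_eq_smul_eq_conjugate`, `exists_ringAut_smul_smul_eq_conjugate`,
  `eq_or_eq_conjugate_of_finrank_eq_two`, `smul_eq_self_or_eq_conjugate_of_finrank_eq_two`,
  `smul_smul_eq_self_of_finrank_eq_two`, `apply_eq_self_of_mem_normalClosure`.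

## References

* [Dodson1984] B. Dodson, *The structure of Galois groups of CM-fields*, Trans. AMS 283 (1984) 1–32, §1.1
  (Imprimitivity Theorem: `ρ` central), §5.1.2 Theorem and §5.1.3 Prop. 1 (p. 20; `n = 3`).
* [Shimura1998] G. Shimura, *Abelian Varieties with Complex Multiplication and Modular Functions* (1998), §8.2
  (primitive and induced CM types).
* [MoonenZarhin1999LowDim] B. Moonen, Yu. Zarhin, Math. Ann. 315 (1999) 711–733, section "Hodge groups of simple
  abelian surfaces of CM-type".
* [Gordon1999HodgeAVSurvey] B. B. Gordon, *A survey of the Hodge conjecture for abelian varieties*, 7.5, 10.10.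
* [Deligne1982HodgeCycles] P. Deligne, LNM 900 (1982), §5 (b).
* [MumfordAV1970] D. Mumford, *Abelian Varieties*, §19.
* [Ribet1980] K. Ribet, *Division fields of abelian varieties with complex multiplication*, Mém. SMF 2 (1980), (3.7).
* [Lang2002] S. Lang, *Algebra*, 3rd ed., VI §1 Cor. 1.4 (Galois correspondence), V §3 Thm. 3.3.

Provenance: Literature home of the used declarations of the Summits-side modules listed part by part above (cells
`pub-hodge-ring2` / `pub-hodgecm2`; namespaces `Summit.HodgeConjecture.CorCM.CyclicSextic`,
`Summit.HodgeConjecture.CorCM.Domination.AVDominatedBy`, `Summit.HodgeConjecture.CorCM.QuarticCM` re-rooted under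
`Literature.AlgebraicGeometry.…` as stated), whose imports are `Literature/` and Mathlib only for the declarations
used; re-homed verbatim (proofs unchanged) so that Literature users are served without importing `Summits/`. Lane
`lit-hodgefound`, seat p20 (generation 34). Theorems only: no definition, no named fact, no `sorry`; axioms `propext`,
`Classical.choice`, `Quot.sound`.
-/

/-! ## Part 1: CyclicSexticCMTypes -/

noncomputable section

namespace Literature.AlgebraicGeometry.ComplexMultiplication.CyclicSextic

open NumberField NumberField.ComplexEmbedding
open Literature.NumberTheory.ComplexMultiplication (conjGal conjGal_apply conjGal_mul_conjGal commute_conjGal)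
open Literature.NumberTheory.ComplexMultiplication.CMTypeOps

variable {K : Type} [Field K] [NumberField K] [IsCMField K]

/-! ## 1. Complex conjugation inside `Gal(K/ℚ)` and the cyclic structure in degree 6 -/

/-- Complex conjugation of a CM field induces complex conjugation under EVERY complex embedding:
`φ̄ = φ ∘ ρ` for `ρ = conjGal`. [cite: Shimura1998, §18.2 Lemma (i)] -/
theorem conjugate_eq_comp_conjGal (φ : K →+* ℂ) :
    conjugate φ = φ.comp (conjGal : K ≃ₐ[ℚ] K).toRingEquiv.toRingHom := by
  ext x
  rw [conjugate_coe_eq, RingHom.coe_comp, Function.comp_apply]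
  change starRingEnd ℂ (φ x) = φ ((conjGal : K ≃ₐ[ℚ] K) x)
  rw [conjGal_apply, IsCMField.complexEmbedding_complexConj]

/-- `ρ ≠ 1` and `ρ` has order `2`. [cite: Shimura1998, §18.2 Lemma (i)] -/
theorem orderOf_conjGal : orderOf (conjGal : K ≃ₐ[ℚ] K) = 2 := by
  refine orderOf_eq_prime_iff.mpr ⟨?_, ?_⟩
  · rw [pow_two]; exact conjGal_mul_conjGal
  · intro h
    obtain ⟨φ⟩ : Nonempty (K →+* ℂ) := inferInstance
    have hreal : ComplexEmbedding.IsReal φ := by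
      rw [ComplexEmbedding.isReal_iff, conjugate_eq_comp_conjGal φ, h]
      ext x; rfl
    exact IsTotallyComplex.complexEmbedding_not_isReal φ hreal

variable [IsGalois ℚ K]

omit [IsCMField K] in
/-- For `K` Galois of degree `6`, `Gal(K/ℚ)` has `6` elements. [cite: Shimura1998, §18.2 Lemma (i)] -/
theorem card_gal_eq_six (h6 : Module.finrank ℚ K = 6) : Nat.card (K ≃ₐ[ℚ] K) = 6 :=
  (IsGalois.card_aut_eq_finrank ℚ K).trans h6

/-- **A Galois CM field of degree 6 has cyclic Galois group**, generated by an element `σ` of order `6`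
with `σ³ = ρ` (complex conjugation): `ρ` is central of order `2`, an element of order `3` exists (Cauchy),
and the product of two commuting elements of coprime orders `2`, `3` has order `6`. [cite: Shimura1998, §18.2 Lemma (i)] -/
theorem exists_generator (h6 : Module.finrank ℚ K = 6) :
    ∃ σ : K ≃ₐ[ℚ] K, orderOf σ = 6 ∧ σ ^ 3 = conjGal := by
  classical
  have hcard : Fintype.card (K ≃ₐ[ℚ] K) = 6 := by
    rw [← Nat.card_eq_fintype_card]; exact card_gal_eq_six h6
  haveI : Fact (Nat.Prime 3) := ⟨by norm_num⟩
  obtain ⟨g, hg⟩ := exists_prime_orderOf_dvd_card 3 (show 3 ∣ Fintype.card (K ≃ₐ[ℚ] K) by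
    rw [hcard]; norm_num)
  have hcomm : Commute g (conjGal : K ≃ₐ[ℚ] K) := (commute_conjGal g).symm
  have hcop : (orderOf g).Coprime (orderOf (conjGal : K ≃ₐ[ℚ] K)) := by
    rw [hg, orderOf_conjGal]; decide
  refine ⟨g * conjGal, ?_, ?_⟩
  · rw [hcomm.orderOf_mul_eq_mul_orderOf_of_coprime hcop, hg, orderOf_conjGal]
  · rw [hcomm.mul_pow, pow_succ (conjGal : K ≃ₐ[ℚ] K) 2, ← orderOf_conjGal (K := K),
      pow_orderOf_eq_one, one_mul, ← hg, pow_orderOf_eq_one, one_mul]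

end Literature.AlgebraicGeometry.ComplexMultiplication.CyclicSextic

end

/-! ## Part 2: QuarticCMTypeSlice -/

noncomputable section

open _root_.CategoryTheory _root_.CategoryTheory.Limits NumberField NumberField.ComplexEmbedding _root_.AlgebraicGeometry
open Literature.AlgebraicGeometry Literature.AlgebraicGeometry.Motives Literature.AlgebraicGeometry.HodgeTheory
open Literature.AlgebraicGeometry.ComplexMultiplication Literature.AlgebraicGeometry.Milne1999
open Literature.AlgebraicGeometry.Pohlmann1968
open Literature.NumberTheory.ComplexMultiplication
open Literature.AlgebraicGeometry.ComplexMultiplication.Domination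

/-! ## §1 Domination factor by factor -/

namespace Literature.AlgebraicGeometry.ComplexMultiplication.QuarticCM

variable {K : Type} [Field K] [NumberField K] [IsCMField K]

/-! ## §2 The chosen realisations `A_{(K,Φ)}`: same type, conjugate type, twisted type -/

omit [IsCMField K] in
/-- `w ↦ a ∘ w` is injective on `Aut(K)`. [cite: MumfordAV1970, §19] -/
theorem comp_algEquiv_injective (a : K →+* ℂ) :
    Function.Injective fun w : K ≃ₐ[ℚ] K => a.comp w.toRingEquiv.toRingHom := fun _ _ h =>
  AlgEquiv.ext fun x => a.injective (RingHom.congr_fun h x)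

omit [IsCMField K] in
/-- **For `K/ℚ` Galois every complex embedding is `a ∘ w`, `w ∈ Gal(K/ℚ)`** (`w ↦ a ∘ w` is injective between two sets
of `[K:ℚ]` elements). [cite: MumfordAV1970, §19] -/
theorem exists_eq_comp_algEquiv [IsGalois ℚ K] (a σ : K →+* ℂ) :
    ∃ w : K ≃ₐ[ℚ] K, σ = a.comp w.toRingEquiv.toRingHom := by
  classical
  have hbij : Function.Bijective fun w : K ≃ₐ[ℚ] K => a.comp w.toRingEquiv.toRingHom := by
    rw [Fintype.bijective_iff_injective_and_card]
    refine ⟨comp_algEquiv_injective a, ?_⟩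
    rw [← Nat.card_eq_fintype_card, IsGalois.card_aut_eq_finrank, Embeddings.card]
  obtain ⟨w, hw⟩ := hbij.2 σ
  exact ⟨w, hw.symm⟩

omit [IsCMField K] in
/-- `(a ∘ w) ∘ x = a ∘ (w x)` (composition of twists). [cite: MumfordAV1970, §19] -/
theorem comp_algEquiv_comp (a : K →+* ℂ) (w x : K ≃ₐ[ℚ] K) :
    (a.comp w.toRingEquiv.toRingHom).comp x.toRingEquiv.toRingHom = a.comp (w * x).toRingEquiv.toRingHom :=
  RingHom.ext fun _ => rfl

omit [IsCMField K] in
/-- `τ ∘ (a ∘ w) = (τ ∘ a) ∘ w` for `τ ∈ Aut(ℂ)`. [cite: MumfordAV1970, §19] -/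
theorem smul_comp_algEquiv (τ : ℂ ≃+* ℂ) (a : K →+* ℂ) (w : K ≃ₐ[ℚ] K) :
    τ • a.comp w.toRingEquiv.toRingHom = (τ • a).comp w.toRingEquiv.toRingHom :=
  RingHom.ext fun _ => rfl

end Literature.AlgebraicGeometry.ComplexMultiplication.QuarticCM

end

/-! ## Part 3: QuarticCMTypeSliceBiquadratic -/

noncomputable section

open _root_.CategoryTheory _root_.CategoryTheory.Limits NumberField NumberField.ComplexEmbedding _root_.AlgebraicGeometry
open Literature.AlgebraicGeometry Literature.AlgebraicGeometry.Motives Literature.AlgebraicGeometry.HodgeTheory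
open Literature.AlgebraicGeometry.ComplexMultiplication Literature.AlgebraicGeometry.Milne1999
open Literature.AlgebraicGeometry.Pohlmann1968
open Literature.NumberTheory.ComplexMultiplication
open Literature.AlgebraicGeometry.ComplexMultiplication.Domination

namespace Literature.AlgebraicGeometry.ComplexMultiplication.QuarticCM

variable {K : Type} [Field K] [NumberField K] [IsCMField K]

/-! ## §2 Biquadratic quartic CM fields -/

omit [IsCMField K] in
/-- **A non-cyclic `Gal(K/ℚ)` of order `4` has exponent `2`**: `g² = 1` for every `g` (an element of order `4` would
generate). [cite: MoonenZarhin1999LowDim, section "Hodge groups of simple abelian surfaces of CM-type"] -/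
theorem mul_self_eq_one_of_not_isCyclic [IsGalois ℚ K] (h4 : Module.finrank ℚ K = 4) (hK : ¬IsCyclic (K ≃ₐ[ℚ] K))
    (g : K ≃ₐ[ℚ] K) : g * g = 1 := by
  classical
  have hcard : Fintype.card (K ≃ₐ[ℚ] K) = 4 := by rw [← Nat.card_eq_fintype_card, IsGalois.card_aut_eq_finrank, h4]
  have hdvd : orderOf g ∣ 2 ^ 2 := by rw [show (2 : ℕ) ^ 2 = 4 by norm_num, ← hcard]; exact orderOf_dvd_card
  obtain ⟨k, hk, hk'⟩ := (Nat.dvd_prime_pow Nat.prime_two).1 hdvd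
  interval_cases k
  · rw [pow_zero, orderOf_eq_one_iff] at hk'; rw [hk', mul_one]
  · rw [pow_one] at hk'; rw [← pow_two, ← hk', pow_orderOf_eq_one]
  · exact absurd (isCyclic_of_orderOf_eq_card g (by rw [hk', Nat.card_eq_fintype_card, hcard]; norm_num)) hK

omit [IsCMField K] in
/-- Membership of a twist `a ∘ w` in `{a, a ∘ h}`: `a ∘ w ∈ Φ ↔ w ∈ {1, h}`. [cite: MoonenZarhin1999LowDim, section "Hodge groups of simple abelian surfaces of CM-type"] -/
theorem comp_mem_iff_of_pair {a : K →+* ℂ} {h : K ≃ₐ[ℚ] K} {Φ : CMType K}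
    (hΦ : ∀ s, s ∈ Φ.1 ↔ s = a ∨ s = a.comp h.toRingEquiv.toRingHom) (w : K ≃ₐ[ℚ] K) :
    a.comp w.toRingEquiv.toRingHom ∈ Φ.1 ↔ w = 1 ∨ w = h := by
  rw [hΦ]
  have h1 : a.comp w.toRingEquiv.toRingHom = a ↔ w = 1 :=
    ⟨fun e => comp_algEquiv_injective a (e.trans (RingHom.ext fun _ => rfl)), fun e => by rw [e]; rfl⟩
  rw [h1, (comp_algEquiv_injective a).eq_iff]

omit [IsCMField K] in
/-- **In exponent `2`, no translate of `{a, a ∘ h}` separates `a` from `a ∘ h`** (`τa = a ∘ w ∈ Φ ↔ w ∈ {1,h} ↔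
wh ∈ {1, h} ↔ τ(a ∘ h) ∈ Φ`, as `h² = 1`): the type is induced from the fixed field of `h`. [cite: Shimura1998, §8.2 Prop. 26] -/
theorem forall_smul_mem_iff_of_mul_self_eq_one [IsGalois ℚ K] {a : K →+* ℂ} {h : K ≃ₐ[ℚ] K} (hh : h * h = 1)
    {Φ : CMType K} (hΦ : ∀ s, s ∈ Φ.1 ↔ s = a ∨ s = a.comp h.toRingEquiv.toRingHom) (τ : ℂ ≃+* ℂ) :
    τ • a ∈ Φ.1 ↔ τ • a.comp h.toRingEquiv.toRingHom ∈ Φ.1 := by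
  obtain ⟨w, hw⟩ := exists_eq_comp_algEquiv a (τ • a)
  rw [smul_comp_algEquiv, hw, comp_algEquiv_comp, comp_mem_iff_of_pair hΦ, comp_mem_iff_of_pair hΦ]
  have e1 : w * h = 1 ↔ w = h := by
    rw [mul_eq_one_iff_eq_inv, inv_eq_of_mul_eq_one_right hh]
  have e2 : w * h = h ↔ w = 1 :=
    ⟨fun e => mul_right_cancel (e.trans (one_mul h).symm), fun e => by rw [e, one_mul]⟩
  rw [e1, e2, or_comm]

end Literature.AlgebraicGeometry.ComplexMultiplication.QuarticCM

end

/-! ## Part 4: QuarticCMTypeReflection -/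

noncomputable section

open NumberField NumberField.ComplexEmbedding
open scoped Cardinal

namespace Literature.AlgebraicGeometry.ComplexMultiplication.QuarticCM

open Literature.NumberTheory.ComplexMultiplication
open Literature.NumberTheory.ComplexMultiplication.CMTypeOps (mem_iff_conjugate_notMem)
open Literature.AlgebraicGeometry.Motives (CMType)
open Literature.AlgebraicGeometry.Pohlmann1968
open Literature.AlgebraicGeometry.ComplexMultiplication.CyclicSextic (conjugate_eq_comp_conjGal orderOf_conjGal)

variable {K : Type} [Field K] [NumberField K] [IsCMField K]

/-! ## §1 The four complex embeddings of a quartic CM field -/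

omit [IsCMField K] in
/-- A quartic field has four complex embeddings. [cite: Shimura1998, §8.2 Prop. 26] -/
theorem card_ringHom_eq_four (h4 : Module.finrank ℚ K = 4) : Fintype.card (K →+* ℂ) = 4 := by
  rw [Embeddings.card, h4]

/-- No complex embedding of a CM field is real: `s̄ ≠ s`. [cite: Shimura1998, §8.2 Prop. 26] -/
theorem conjugate_ne (s : K →+* ℂ) : conjugate s ≠ s := fun h =>
  IsTotallyComplex.complexEmbedding_not_isReal s (ComplexEmbedding.isReal_iff.2 h)

/-- `τ ∘ s̄ = \overline{τ ∘ s}` for `τ ∈ Aut(ℂ)` and `s : K → ℂ`, `K` a CM field (complex conjugation of `K` is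
carried to that of `ℂ` by every embedding). [cite: Shimura1998, §8.2 Prop. 26] -/
theorem smul_conjugate (τ : ℂ ≃+* ℂ) (s : K →+* ℂ) : τ • conjugate s = conjugate (τ • s) := by
  refine RingHom.ext fun x => ?_
  change τ (starRingEnd ℂ (s x)) = starRingEnd ℂ (τ (s x))
  rw [← IsCMField.complexEmbedding_complexConj K s x]
  exact IsCMField.complexEmbedding_complexConj K ((τ : ℂ →+* ℂ).comp s) x

section Four

variable {a b : K →+* ℂ}

open scoped Classical in
/-- The four embeddings `a, ā, b, b̄` are pairwise distinct and exhaust `Hom(K, ℂ)` (as a `Finset`). [cite: Shimura1998, §8.2 Prop. 26] -/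
theorem univ_eq_four (h4 : Module.finrank ℚ K = 4) (hba : b ≠ a) (hba' : b ≠ conjugate a) :
    (Finset.univ : Finset (K →+* ℂ)) = {a, conjugate a, b, conjugate b} := by
  have hab' : conjugate b ≠ a := fun h => hba' (by rw [← h, involutive_conjugate K b])
  have hcc : conjugate b ≠ conjugate a := fun h => hba ((involutive_conjugate K).injective h)
  have hcard : ({a, conjugate a, b, conjugate b} : Finset (K →+* ℂ)).card = 4 := by
    rw [Finset.card_insert_of_notMem (by simp [(conjugate_ne a).symm, hba.symm, hab'.symm]),
      Finset.card_insert_of_notMem (by simp [hba'.symm, hcc.symm]), Finset.card_pair (conjugate_ne b).symm]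
  exact (Finset.eq_univ_of_card _ (by rw [hcard, card_ringHom_eq_four h4])).symm

/-- **`Hom(K, ℂ) = {a, ā, b, b̄}`** for a quartic CM field and `b ∉ {a, ā}`. [cite: Shimura1998, §8.2 Prop. 26] -/
theorem eq_or_eq_or_eq_or_eq (h4 : Module.finrank ℚ K = 4) (hba : b ≠ a) (hba' : b ≠ conjugate a)
    (s : K →+* ℂ) : s = a ∨ s = conjugate a ∨ s = b ∨ s = conjugate b := by
  classical
  have hs : s ∈ ({a, conjugate a, b, conjugate b} : Finset (K →+* ℂ)) :=
    univ_eq_four h4 hba hba' ▸ Finset.mem_univ s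
  simpa using hs

/-- `Σ_{s : K → ℂ} g(s) = g(a) + g(ā) + g(b) + g(b̄)`. [cite: Shimura1998, §8.2 Prop. 26] -/
theorem sum_eq_add_four {M : Type*} [AddCommMonoid M] (h4 : Module.finrank ℚ K = 4) (hba : b ≠ a)
    (hba' : b ≠ conjugate a) (g : (K →+* ℂ) → M) :
    ∑ s, g s = g a + g (conjugate a) + g b + g (conjugate b) := by
  classical
  have hab' : conjugate b ≠ a := fun h => hba' (by rw [← h, involutive_conjugate K b])
  have hcc : conjugate b ≠ conjugate a := fun h => hba ((involutive_conjugate K).injective h)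
  rw [univ_eq_four h4 hba hba', Finset.sum_insert (by simp [(conjugate_ne a).symm, hba.symm, hab'.symm]),
    Finset.sum_insert (by simp [hba'.symm, hcc.symm]), Finset.sum_pair (conjugate_ne b).symm, add_assoc, add_assoc]

end Four

/-- **A CM type of a quartic CM field is a pair `{a, b}` with `b ∉ {a, ā}`.** [cite: Shimura1998, §8.2 Prop. 26] -/
theorem exists_mem_mem_ne (h4 : Module.finrank ℚ K = 4) (Φ : CMType K) :
    ∃ a b : K →+* ℂ, b ≠ a ∧ b ≠ conjugate a ∧ ∀ s, s ∈ Φ.1 ↔ s = a ∨ s = b := by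
  classical
  obtain ⟨a₀⟩ : Nonempty (K →+* ℂ) := inferInstance
  -- an element `a ∈ Φ`
  obtain ⟨a, ha⟩ : ∃ a, a ∈ Φ.1 := by
    rcases CMTypeOps.mem_or_conjugate_mem Φ a₀ with h | h
    exacts [⟨a₀, h⟩, ⟨conjugate a₀, h⟩]
  -- an embedding outside `{a, ā}`
  obtain ⟨s, -, hs⟩ : ∃ s, s ∈ (Finset.univ : Finset (K →+* ℂ)) ∧ s ∉ ({a, conjugate a} : Finset (K →+* ℂ)) :=
    Finset.exists_mem_notMem_of_card_lt_card
      (lt_of_le_of_lt Finset.card_le_two (by rw [Finset.card_univ, card_ringHom_eq_four h4]; norm_num))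
  simp only [Finset.mem_insert, Finset.mem_singleton, not_or] at hs
  obtain ⟨hsa, hsa'⟩ := hs
  -- the element of `Φ` over the place of `s`
  obtain ⟨b, hb, hbs⟩ : ∃ b, b ∈ Φ.1 ∧ (b = s ∨ b = conjugate s) := by
    rcases CMTypeOps.mem_or_conjugate_mem Φ s with h | h
    exacts [⟨s, h, Or.inl rfl⟩, ⟨conjugate s, h, Or.inr rfl⟩]
  have hba : b ≠ a := by
    rcases hbs with h | h <;> rw [h]
    · exact hsa
    · intro h'; exact hsa' (by rw [← h', involutive_conjugate K])
  have hba' : b ≠ conjugate a := fun h => (mem_iff_conjugate_notMem Φ a).1 ha (h ▸ hb)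
  refine ⟨a, b, hba, hba', fun t => ⟨fun ht => ?_, ?_⟩⟩
  · rcases eq_or_eq_or_eq_or_eq h4 hba hba' t with h | h | h | h
    · exact Or.inl h
    · exact absurd (h ▸ ht) ((mem_iff_conjugate_notMem Φ a).1 ha)
    · exact Or.inr h
    · exact absurd (h ▸ ht) ((mem_iff_conjugate_notMem Φ b).1 hb)
  · rintro (rfl | rfl)
    exacts [ha, hb]

omit [IsCMField K] in
/-- `|Aut(K)| ≤ 4`: `g ↦ a ∘ g` embeds `Aut(K)` into the four complex embeddings. [cite: Shimura1998, §8.2 Prop. 26] -/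
theorem card_algEquiv_le_four (h4 : Module.finrank ℚ K = 4) : Fintype.card (K ≃ₐ[ℚ] K) ≤ 4 := by
  classical
  obtain ⟨a⟩ : Nonempty (K →+* ℂ) := inferInstance
  rw [← card_ringHom_eq_four h4]
  refine Fintype.card_le_of_injective (fun g : K ≃ₐ[ℚ] K => a.comp g.toRingEquiv.toRingHom) fun g g' h => ?_
  ext x
  exact a.injective (RingHom.congr_fun h x)

/-- **For a quartic CM field which is NOT Galois over `ℚ`, `Aut(K) = {1, c}`** (`|Aut(K)| < 4` and `c` has order
`2`, so `|Aut(K)| = 2`). [cite: Shimura1998, §8.2 Prop. 26] -/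
theorem algEquiv_eq_one_or_eq_conjGal_of_not_isGalois (h4 : Module.finrank ℚ K = 4) (hK : ¬IsGalois ℚ K)
    (g : K ≃ₐ[ℚ] K) : g = 1 ∨ g = conjGal := by
  classical
  have hle := card_algEquiv_le_four h4
  have hne : Fintype.card (K ≃ₐ[ℚ] K) ≠ 4 := fun h =>
    hK (IsGalois.of_card_aut_eq_finrank ℚ K (by rw [Nat.card_eq_fintype_card, h, h4]))
  have hdvd : 2 ∣ Fintype.card (K ≃ₐ[ℚ] K) := by
    rw [← orderOf_conjGal (K := K)]; exact orderOf_dvd_card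
  have hcard : Fintype.card (K ≃ₐ[ℚ] K) = 2 := by
    obtain ⟨m, hm⟩ := hdvd
    have hpos : 0 < Fintype.card (K ≃ₐ[ℚ] K) := Fintype.card_pos
    omega
  have htop : Subgroup.zpowers (conjGal : K ≃ₐ[ℚ] K) = ⊤ := by
    apply Subgroup.eq_top_of_card_eq
    rw [Nat.card_zpowers, orderOf_conjGal, Nat.card_eq_fintype_card, hcard]
  have hg : g ∈ Subgroup.zpowers (conjGal : K ≃ₐ[ℚ] K) := htop ▸ Subgroup.mem_top g
  obtain ⟨k, rfl⟩ := Subgroup.mem_zpowers_iff.1 hg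
  have h2 : (conjGal : K ≃ₐ[ℚ] K) ^ (2 : ℤ) = 1 := by
    rw [show (2 : ℤ) = ((2 : ℕ) : ℤ) from rfl, zpow_natCast, pow_two, conjGal_mul_conjGal]
  rcases Int.even_or_odd k with ⟨m, rfl⟩ | ⟨m, rfl⟩
  · left
    rw [← two_mul, zpow_mul, h2, one_zpow]
  · right
    rw [zpow_add, zpow_one, zpow_mul, h2, one_zpow, one_mul]

/-! ## §3 The reflection `τ`: fixes `a`, sends `b` to `b̄` -/

omit [IsCMField K] in
/-- If `b(K) ⊆ a(K)` then `b = a ∘ g` for an automorphism `g` of `K` (`a⁻¹ ∘ b` is an injective endomorphism of the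
number field `K`, hence bijective). [cite: Shimura1998, §8.2 Prop. 26] -/
theorem exists_algEquiv_comp_eq_of_forall_mem_range {a b : K →+* ℂ} (h : ∀ x, b x ∈ Set.range a) :
    ∃ g : K ≃ₐ[ℚ] K, b = a.comp g.toRingEquiv.toRingHom := by
  let aQ : K →ₐ[ℚ] ℂ := a.toRatAlgHom
  let bQ : K →ₐ[ℚ] ℂ := b.toRatAlgHom
  have hle : bQ.range ≤ aQ.range := by
    rintro _ ⟨y, rfl⟩
    obtain ⟨z, hz⟩ := h y
    exact ⟨z, hz⟩
  let ea : K ≃ₐ[ℚ] aQ.range := AlgEquiv.ofInjectiveField aQ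
  let eb : K ≃ₐ[ℚ] bQ.range := AlgEquiv.ofInjectiveField bQ
  let g₀ : K →ₐ[ℚ] K :=
    (ea.symm : aQ.range →ₐ[ℚ] K).comp ((Subalgebra.inclusion hle).comp (eb : K →ₐ[ℚ] bQ.range))
  have hea : ∀ w : aQ.range, a (ea.symm w) = w := fun w => by
    have h1 : ((ea (ea.symm w) : aQ.range) : ℂ) = a (ea.symm w) := rfl
    rw [← h1, AlgEquiv.apply_symm_apply]
  have hg₀ : ∀ x, a (g₀ x) = b x := fun x => by
    change a (ea.symm (Subalgebra.inclusion hle (eb x))) = b x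
    rw [hea, Subalgebra.coe_inclusion]
    rfl
  refine ⟨AlgEquiv.ofBijective g₀ (Algebra.IsAlgebraic.algHom_bijective g₀), RingHom.ext fun x => ?_⟩
  exact (hg₀ x).symm

/-- **The dihedral reflection.**  For a quartic CM field `K` and embeddings `a, b : K → ℂ` such that `b` is NOT a
twist `a ∘ g` (`g ∈ Aut(K)`), there is an automorphism `τ` of `ℂ` with `τ ∘ a = a` and `τ ∘ b = b̄`: some `b(x)`
lies outside the countable subfield `a(K)` and is moved by an automorphism fixing `a(K)` pointwise
(`Literature.FieldTheory.AlgClosed.Complex.exists_ringEquiv_fix_apply_ne`); that automorphism fixes `a` and `ā` and moves `b` inside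
`{a, ā, b, b̄}`, i.e. to `b̄`. [cite: Shimura1998, §8.2 Prop. 26] -/
theorem exists_ringAut_smul_eq_self_smul_eq_conjugate (h4 : Module.finrank ℚ K = 4) {a b : K →+* ℂ}
    (hb : ∀ g : K ≃ₐ[ℚ] K, b ≠ a.comp g.toRingEquiv.toRingHom) :
    ∃ τ : ℂ ≃+* ℂ, τ • a = a ∧ τ • b = conjugate b := by
  classical
  have hba : b ≠ a := fun h => hb 1 (by rw [h]; rfl)
  have hba' : b ≠ conjugate a := fun h => hb conjGal (by rw [h, conjugate_eq_comp_conjGal])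
  -- some value of `b` lies outside `a(K)`
  obtain ⟨x, hx⟩ : ∃ x : K, b x ∉ Set.range a := by
    by_contra h
    simp only [not_exists, not_not] at h
    obtain ⟨g, hg⟩ := exists_algEquiv_comp_eq_of_forall_mem_range h
    exact hb g hg
  -- an automorphism of `ℂ` fixing `a(K)` pointwise and moving `b x`
  haveI : Countable K := Literature.NumberTheory.Automorphic.NumberField.countable' K
  have hF : #(a.fieldRange) ≤ ℵ₀ := by
    rw [Cardinal.mk_le_aleph0_iff]
    exact (Set.countable_range (a : K → ℂ)).to_subtype
  obtain ⟨τ, hfix, hmove⟩ := Literature.FieldTheory.AlgClosed.Complex.exists_ringEquiv_fix_apply_ne a.fieldRange hF (z := b x)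
    (fun hmem => hx (RingHom.mem_fieldRange.1 hmem))
  have hτa : τ • a = a := RingHom.ext fun y => hfix (a y) (RingHom.mem_fieldRange.2 ⟨y, rfl⟩)
  refine ⟨τ, hτa, ?_⟩
  rcases eq_or_eq_or_eq_or_eq h4 hba hba' (τ • b) with h | h | h | h
  · exact absurd (smul_left_cancel τ (h.trans hτa.symm)) hba
  · refine absurd (smul_left_cancel τ (h.trans ?_)) hba'
    rw [smul_conjugate, hτa]
  · exact absurd (RingHom.congr_fun h x) hmove
  · exact h

/-- For `K/ℚ` NOT Galois the reflection exists for every pair `b ∉ {a, ā}` (`Aut(K) = {1, c}`). [cite: Shimura1998, §8.2 Prop. 26] -/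
theorem exists_ringAut_smul_eq_self_smul_eq_conjugate_of_not_isGalois (h4 : Module.finrank ℚ K = 4)
    (hK : ¬IsGalois ℚ K) {a b : K →+* ℂ} (hba : b ≠ a) (hba' : b ≠ conjugate a) :
    ∃ τ : ℂ ≃+* ℂ, τ • a = a ∧ τ • b = conjugate b := by
  refine exists_ringAut_smul_eq_self_smul_eq_conjugate h4 fun g hg => ?_
  rcases algEquiv_eq_one_or_eq_conjGal_of_not_isGalois h4 hK g with rfl | rfl
  · exact hba (by rw [hg]; rfl)
  · exact hba' (by rw [hg, conjugate_eq_comp_conjGal])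

/-! ## §4 Primitivity and nondegeneracy of the CM types of a non-Galois quartic CM field -/

/-- **With the reflection at hand, `Φ = {a, b}` is primitive**: `1` and `τ` separate the four embeddings by their
membership in `Φ` (Kubota's criterion `isPrimitive_iff_forall_eq`). [cite: Shimura1998, §8.2 Prop. 26] -/
theorem isPrimitive_of_reflection (h4 : Module.finrank ℚ K = 4) {a b : K →+* ℂ} (hba : b ≠ a)
    (hba' : b ≠ conjugate a) {τ : ℂ ≃+* ℂ} (hτa : τ • a = a) (hτb : τ • b = conjugate b)
    (Φ : CMType K) (hΦ : ∀ s, s ∈ Φ.1 ↔ s = a ∨ s = b) (φ₀ : K →+* ℂ) :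
    IsPrimitive (ℂ ≃+* ℂ) Φ.1 φ₀ := by
  haveI := isPretransitive_ringEquiv_complex (K := K)
  rw [isPrimitive_iff_forall_eq]
  intro x y hxy
  have ha : a ∈ Φ.1 := (hΦ a).2 (Or.inl rfl)
  have hb : b ∈ Φ.1 := (hΦ b).2 (Or.inr rfl)
  have hna : conjugate a ∉ Φ.1 := (mem_iff_conjugate_notMem Φ a).1 ha
  have hnb : conjugate b ∉ Φ.1 := (mem_iff_conjugate_notMem Φ b).1 hb
  have hτa' : τ • conjugate a = conjugate a := by rw [smul_conjugate, hτa]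
  have hτb' : τ • conjugate b = b := by rw [smul_conjugate, hτb, involutive_conjugate]
  have h1 := hxy 1
  have h2 := hxy τ
  simp only [one_smul] at h1
  rcases eq_or_eq_or_eq_or_eq h4 hba hba' x with hx | hx | hx | hx <;>
    rcases eq_or_eq_or_eq_or_eq h4 hba hba' y with hy | hy | hy | hy <;>
    rw [hx, hy] at h1 h2 ⊢ <;>
    first
    | rfl
    | (exfalso; simp only [hτa, hτa', hτb, hτb'] at h2; tauto)

/-- **Every CM type of a non-Galois quartic CM field is primitive** (its abelian surfaces are simple; equivalently
the field has no imaginary quadratic subfield). [cite: Shimura1998, §8.2 Prop. 26] -/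
theorem isPrimitive_of_not_isGalois (h4 : Module.finrank ℚ K = 4) (hK : ¬IsGalois ℚ K) (Φ : CMType K)
    (φ₀ : K →+* ℂ) : IsPrimitive (ℂ ≃+* ℂ) Φ.1 φ₀ := by
  obtain ⟨a, b, hba, hba', hΦ⟩ := exists_mem_mem_ne h4 Φ
  obtain ⟨τ, hτa, hτb⟩ := exists_ringAut_smul_eq_self_smul_eq_conjugate_of_not_isGalois h4 hK hba hba'
  exact isPrimitive_of_reflection h4 hba hba' hτa hτb Φ hΦ φ₀

end Literature.AlgebraicGeometry.ComplexMultiplication.QuarticCM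

end

/-! ## Part 5: QuarticCMConjugationSquare -/

noncomputable section

open NumberField NumberField.ComplexEmbedding IntermediateField

namespace Literature.AlgebraicGeometry.ComplexMultiplication.QuarticCM

open Literature.NumberTheory.ComplexMultiplication
open Literature.AlgebraicGeometry.Pohlmann1968

/-! ## §1 `K/ℚ` not Galois: complex conjugation on `Hom(K, ℂ)` is the square of a `4`-cycle -/

section Quartic

variable {K : Type} [Field K] [NumberField K] [IsCMField K]

omit [IsCMField K] in
/-- A quartic field has an embedding outside any pair `{a, ā}` (there are four embeddings). [cite: Shimura1998, §8.4 (2)] -/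
theorem exists_ne_ne_conjugate (h4 : Module.finrank ℚ K = 4) (a : K →+* ℂ) :
    ∃ b : K →+* ℂ, b ≠ a ∧ b ≠ conjugate a := by
  classical
  by_contra h
  push Not at h
  have hsub : (Finset.univ : Finset (K →+* ℂ)) ⊆ {a, conjugate a} := fun s _ => by
    by_cases hs : s = a
    · simp [hs]
    · simp [h s hs]
  have hle := Finset.card_le_card hsub
  rw [Finset.card_univ, card_ringHom_eq_four h4] at hle
  exact absurd (hle.trans Finset.card_le_two) (by norm_num)

/-- **A `4`-cycle in the image of `Aut(ℂ)`.**  For a quartic CM field `K` that is NOT Galois over `ℚ` and embeddings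
`b ∉ {a, ā}`, some `τ ∈ Aut(ℂ)` has `τ ∘ a = b` and `τ ∘ b = ā` (so `τ` permutes the four embeddings cyclically as
`(a b ā b̄)`): a `g` with `g ∘ a = b` exists by transitivity, `g ∘ b ∈ {a, ā}`, and if `g ∘ b = a` one composes with the
reflection `τ₀` (`τ₀ ∘ a = a`, `τ₀ ∘ b = b̄`) of `QuarticCMTypeReflection` §3. [cite: Shimura1998, §8.4 (2)] -/
theorem exists_ringAut_smul_eq_smul_eq_conjugate (h4 : Module.finrank ℚ K = 4) (hK : ¬IsGalois ℚ K) {a b : K →+* ℂ}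
    (hba : b ≠ a) (hba' : b ≠ conjugate a) : ∃ τ : ℂ ≃+* ℂ, τ • a = b ∧ τ • b = conjugate a := by
  haveI := isPretransitive_ringEquiv_complex (K := K)
  obtain ⟨g, hg⟩ := MulAction.exists_smul_eq (ℂ ≃+* ℂ) a b
  have hg' : g • conjugate a = conjugate b := by rw [smul_conjugate, hg]
  rcases eq_or_eq_or_eq_or_eq h4 hba hba' (g • b) with h | h | h | h
  · obtain ⟨τ₀, hτ₀a, hτ₀b⟩ := exists_ringAut_smul_eq_self_smul_eq_conjugate_of_not_isGalois h4 hK hba hba'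
    refine ⟨g * τ₀, ?_, ?_⟩
    · rw [mul_smul, hτ₀a, hg]
    · rw [mul_smul, hτ₀b, smul_conjugate, h]
  · exact ⟨g, hg, h⟩
  · exact absurd (smul_left_cancel g (h.trans hg.symm)) hba
  · exact absurd (smul_left_cancel g (h.trans hg'.symm)) hba'

/-- **Complex conjugation on `Hom(K, ℂ)` is a square in the image of `Aut(ℂ)`** for a quartic CM field `K` that is
NOT Galois over `ℚ`: some `τ ∈ Aut(ℂ)` has `τ ∘ τ ∘ s = s̄` for all four embeddings `s` (the square of the `4`-cycle
`(a b ā b̄)` is `(a ā)(b b̄)`; in the dihedral group of order `8` through which `Aut(ℂ)` acts, the central involution is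
a square). [cite: Shimura1998, §8.4 (2)] -/
theorem exists_ringAut_smul_smul_eq_conjugate (h4 : Module.finrank ℚ K = 4) (hK : ¬IsGalois ℚ K) :
    ∃ τ : ℂ ≃+* ℂ, ∀ s : K →+* ℂ, τ • τ • s = conjugate s := by
  obtain ⟨a⟩ : Nonempty (K →+* ℂ) := inferInstance
  obtain ⟨b, hba, hba'⟩ := exists_ne_ne_conjugate h4 a
  obtain ⟨τ, hτa, hτb⟩ := exists_ringAut_smul_eq_smul_eq_conjugate h4 hK hba hba'
  have hτa' : τ • conjugate a = conjugate b := by rw [smul_conjugate, hτa]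
  have hτb' : τ • conjugate b = a := by rw [smul_conjugate, hτb, involutive_conjugate K a]
  refine ⟨τ, fun s => ?_⟩
  rcases eq_or_eq_or_eq_or_eq h4 hba hba' s with rfl | rfl | rfl | rfl
  · rw [hτa, hτb]
  · rw [hτa', hτb', involutive_conjugate K a]
  · rw [hτb, hτa']
  · rw [hτb', hτa, involutive_conjugate K b]

end Quartic

/-! ## §2 An imaginary quadratic partner: `Aut(ℂ)` acts on its two embeddings through `{1, ρ}` -/

section Quadratic

variable {k : Type} [Field k] [NumberField k] [IsCMField k]

/-- `Hom(k, ℂ) = {t, t̄}` for an imaginary quadratic field `k` (two embeddings, `t̄ ≠ t`); cf.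
`QuarticCM.eq_or_eq_conjugate_of_quadratic` in `CorCM/QuadraticCMTypeSlice` (same statement, heavier imports). [cite: Shimura1998, §8.4 (2)] -/
theorem eq_or_eq_conjugate_of_finrank_eq_two (h2 : Module.finrank ℚ k = 2) (t s : k →+* ℂ) :
    s = t ∨ s = conjugate t := by
  classical
  by_contra h
  rw [not_or] at h
  have hcard : ({s, t, conjugate t} : Finset (k →+* ℂ)).card = 3 := by
    rw [Finset.card_insert_of_notMem (by simp [h.1, h.2]), Finset.card_pair (conjugate_ne t).symm]
  have hle : ({s, t, conjugate t} : Finset (k →+* ℂ)).card ≤ Fintype.card (k →+* ℂ) := Finset.card_le_univ _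
  rw [hcard, Embeddings.card, h2] at hle
  exact absurd hle (by norm_num)

/-- **Every automorphism of `ℂ` acts on the two embeddings of an imaginary quadratic field either trivially or as
complex conjugation.** [cite: Shimura1998, §8.4 (2)] -/
theorem smul_eq_self_or_eq_conjugate_of_finrank_eq_two (h2 : Module.finrank ℚ k = 2) (γ : ℂ ≃+* ℂ) :
    (∀ t : k →+* ℂ, γ • t = t) ∨ ∀ t : k →+* ℂ, γ • t = conjugate t := by
  obtain ⟨t₀⟩ : Nonempty (k →+* ℂ) := inferInstance
  rcases eq_or_eq_conjugate_of_finrank_eq_two h2 t₀ (γ • t₀) with h | h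
  · refine Or.inl fun t => ?_
    rcases eq_or_eq_conjugate_of_finrank_eq_two h2 t₀ t with rfl | rfl
    · exact h
    · rw [smul_conjugate, h]
  · refine Or.inr fun t => ?_
    rcases eq_or_eq_conjugate_of_finrank_eq_two h2 t₀ t with rfl | rfl
    · exact h
    · rw [smul_conjugate, h, involutive_conjugate k t₀]

/-- The square of every automorphism of `ℂ` fixes both embeddings of an imaginary quadratic field. [cite: Shimura1998, §8.4 (2)] -/
theorem smul_smul_eq_self_of_finrank_eq_two (h2 : Module.finrank ℚ k = 2) (γ : ℂ ≃+* ℂ) (t : k →+* ℂ) :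
    γ • γ • t = t := by
  rcases smul_eq_self_or_eq_conjugate_of_finrank_eq_two h2 γ with h | h
  · rw [h t, h t]
  · rw [h t, smul_conjugate, h t, involutive_conjugate k t]

end Quadratic

/-! ## §3 The abstract two-slot criterion for slotwise independence -/

section NormalClosure

variable {k : Type} [Field k] [NumberField k] [IsCMField k]
variable {K : Type} [Field K] [NumberField K] [IsCMField K]

omit [IsCMField K] in
/-- An automorphism of `ℂ` fixing every embedding of `K` fixes the Galois closure `normalClosure ℚ K ℂ` pointwise
(it is generated by the images of the embeddings). [cite: Lang2002, V §3 Thm. 3.3] -/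
theorem apply_eq_self_of_mem_normalClosure {τ : ℂ ≃+* ℂ} (hτ : ∀ s : K →+* ℂ, τ • s = s) {x : ℂ}
    (hx : x ∈ normalClosure ℚ K ℂ) : τ x = x := by
  let τ' : ℂ ≃ₐ[ℚ] ℂ := AlgEquiv.ofRingEquiv (f := τ) fun q => by simp
  have hle : normalClosure ℚ K ℂ ≤ fixedField (Subgroup.zpowers τ') := by
    refine normalClosure_le_iff.2 fun f => ?_
    rintro _ ⟨y, rfl⟩
    rw [mem_fixedField_iff]
    intro g hg
    have hfix : τ' (f y) = f y := by
      have h := RingHom.congr_fun (hτ f.toRingHom) y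
      change τ (f y) = f y
      simpa using h
    have hst : Subgroup.zpowers τ' ≤ MulAction.stabilizer (ℂ ≃ₐ[ℚ] ℂ) ((f : K →ₐ[ℚ] ℂ) y) :=
      (Subgroup.zpowers_le (G := ℂ ≃ₐ[ℚ] ℂ)).2 (MulAction.mem_stabilizer_iff.2 hfix)
    exact MulAction.mem_stabilizer_iff.1 (hst hg)
  have h := (mem_fixedField_iff _ _).1 (hle hx) τ' (Subgroup.mem_zpowers τ')
  exact h

end NormalClosure

end Literature.AlgebraicGeometry.ComplexMultiplication.QuarticCM

end
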